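import Summits.QuantumFields.YangMills.Theorems.BalabanUVNodesN18TwoBlockLoopStokes
import HarnessLib

/-!
# BalabanUVNodes ∕ node N18 = NE5 — closure-ledger item (iii): THE SHARP BOX STOKES — the `|w|²∕4`-type constant of the tree's global
# `LatticeWordStokes.dist1_holAt_le` recovered INSIDE a coordinate box, and the (0.4) loop variables from the two blocks with the constant `((d+2)L)²∕4`
# (Track A, DAG node N18 = `T4OutputRate.NE5` :211; cluster K4 «SpineRates», item K3⁷ `SpineGivenEndpointR13SepCoPH`; seat pub-ymgap-dag-n18-w3 g4)

HONEST FRAMING.  Count-neutral kernel bookkeeping (`--supports stmt-QuantumFields-20544 --as helper`): folklore lattice gauge bookkeeping (the axial gauge of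
[Balaban1985Averaging] pp. 24–25 read along a closed word from BOTH ends), sequel of this seat's FILE `…N18TwoBlockLoopStokes` (p615425, whose constant is
`((d+2)L)²∕2`).  The sharper constant is what the tree's ATOMISED sharp Proposition 1 for (0.4) (`BlockAveragingEMLProp2.dist1_plaqHol_avgFun_le_of_atoms`) asks of
its loop atoms; the four-block atoms and the local Proposition 1 itself are the two sequel files `…N18FourBlockTransportLoops` ∕ `…N18FourBlockSharpProp1`.
Nothing of Bałaban's renormalization group is asserted; NE5 NOT PRINTED ∕ NOT proved; N18 NOT discharged; nothing about the continuum ∕ OS ∕ mass gap ∕ Clay.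

THE SHARPENING.  Read the axial gauge `V₀` based at `y` along ANY word `u` from a point at `ℓ¹`-distance `≤ m` from `y`: the `k`-th bond has its source within
`m + k + 1` of `y` (`l1_disp_le`), so `‖V₀(u) − 1‖ ≤ α·(|u|·m + |u|(|u|+1)∕2)` and from `y` itself `≤ α·|u|(|u|+1)∕2`.  A CLOSED word `w = w₁w₂` from `y`, split at
`q = ⌊|w|∕2⌋`, has `V_y(w) = V₀,y(w₁)·(V₀,y(w₂⁻¹))⁻¹` with BOTH factors read from `y`, whence `‖V_y(w) − 1‖ ≤ α·(q(q+1) + (n−q)(n−q+1))∕2 ≤ α·(|w|+1)²∕4`; the box-local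
form follows through p615425's clamped-extension step.  The (0.4) loop word has length `≤ (d+2)L − d` (`L` odd), and `(|w|+1)² ≤ ((d+2)L)²` for `d ≥ 1`.

WHAT.
* §1 (`ℤᵈ`) `revWord_revWord`, `norm_hol_axial_sub_one_le_of_l1`, `norm_hol_axial_sub_one_le_triangle`, `two_mul_halves_le_sq`, ★ `norm_hol_closed_sub_one_le_quarter`
  (global plaquette hypothesis), ★★ `norm_hol_closed_sub_one_le_quarter_inBox` (plaquettes with all four corners in the box only).
* §2 (torus) `length_loopWord_add_le`, ★★★ `norm_loopVarU_sub_one_le_quarter`: `‖W_i(c) − 1‖ ≤ (((d+2)L)²∕4)·a` for W1-18's (0.4) loop variables of an `𝔸ˣ`-valued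
  `U`, `U1`-valued on the bonds with both ends in `B(c₋) ∪ B(c₊)`, from `‖U(∂p) − 1‖ ≤ a` for the plaquettes with all four corners there (`j+1 ≤ m+K`).

0 `def`, 0 `sorry`.  References: T. Bałaban, CMP **98** (1985) 17–51 [Balaban1985Averaging] ((9) p.18, (19)–(20) p.21, pp.24–25); CMP **109** (1987) 249–301
[Balaban1987RG1] ((0.3)–(0.4) pp.252–253).
-/

noncomputable section

open scoped BigOperators

namespace YMDAG.N18.BoxStokes

open Literature.MathematicalPhysics.QuantumFieldTheory.Balaban1983to89
open Literature.MathematicalPhysics.QuantumFieldTheory.Balaban1983to89.B7Prop1Explicit renaming Site → LSite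
open Literature.MathematicalPhysics.QuantumFieldTheory.Balaban1983to89.B7Prop1Explicit (Letter e e_apply disp disp_cons disp_nil disp_append disp_revWord hol hol_cons
  hol_nil hol_append hol_revWord' revWord stepHol stepHol_true stepHol_false l1 l1_disp_le U1 mem_U1 norm_inv_sub_one_le hol_mem stepHol_mem gaugeAct_mem axialFn_mem
  gaugeAct axialFn axial_bond_bound hol_gaugeAct_closed plaqWord)
open Literature.MathematicalPhysics.QuantumFieldTheory.Balaban1983to89.B7Prop1Local (InBox PlaqIn AgreeOn clampCfg clampCfg_agree norm_hol_plaqWord_clampCfg_le)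

/-! ## §1 `ℤᵈ`: the axial gauge read from both ends of a closed word -/

section Zd

variable {d : ℕ}

/-- Reversing a word twice gives it back. [folklore] -/
theorem revWord_revWord (w : List (Letter d)) : revWord (revWord w) = w := by
  induction w with
  | nil => rfl
  | cons l w ih =>
    rw [B7Prop1Explicit.revWord_cons, B7Prop1Explicit.revWord_append, ih]
    obtain ⟨μ, b⟩ := l
    simp [revWord, Letter.rev]

variable {𝔸 : Type*} [NormedRing 𝔸] [NormOneClass 𝔸]

/-- **The axial gauge read along any word from a point at `ℓ¹`-distance `≤ m` from its base**: if `V` is `U1`-valued with all plaquettes within `α` of `1`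
and `V₀ = V^{v₀}` is the axial gauge based at `y` (`axial_bond_bound`: `‖V₀(b) − 1‖ ≤ |b₋ − y|₁·α`), then for every word `u` from `x` with `|x − y|₁ ≤ m`,
`‖V₀,x(u) − 1‖ ≤ α·(|u|·m + |u|(|u|+1)∕2)` — the `k`-th bond has its source within `m + k + 1` of `y`. [cite: Balaban1985Averaging, pp.24-25] -/
theorem norm_hol_axial_sub_one_le_of_l1 {V : LSite d → Fin d → 𝔸ˣ} (hV : ∀ x κ, V x κ ∈ U1 𝔸) {α : ℝ} (hα : 0 ≤ α)
    (h44 : ∀ (x : LSite d) (κ μ : Fin d), κ ≠ μ → ‖((hol V x (plaqWord κ μ) : 𝔸ˣ) : 𝔸) - 1‖ ≤ α) (y : LSite d) :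
    ∀ (u : List (Letter d)) (x : LSite d) (m : ℕ), l1 (x - y) ≤ m →
      ‖((hol (gaugeAct (axialFn V y) V) x u : 𝔸ˣ) : 𝔸) - 1‖ ≤ α * (u.length * m + u.length * (u.length + 1) / 2)
  | [], x, m, _ => by simp
  | l :: u, x, m, hx => by
    have hV₀m : ∀ x κ, gaugeAct (axialFn V y) V x κ ∈ U1 𝔸 := gaugeAct_mem hV (axialFn_mem hV y)
    rw [hol_cons, Units.val_mul, List.length_cons]
    -- the next position is within `m + 1` of `y`
    have hxl : l1 (x + l.vec - y) ≤ m + 1 := by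
      have h1 : l1 (x + l.vec - y) ≤ l1 l.vec + l1 (x - y) := by
        rw [show x + l.vec - y = l.vec + (x - y) by abel]; exact B7Prop1Explicit.l1_add_le _ _
      rw [B7Prop1Explicit.l1_vec] at h1
      omega
    have ih := norm_hol_axial_sub_one_le_of_l1 hV hα h44 y u (x + l.vec) (m + 1) hxl
    have hstep : ‖((stepHol (gaugeAct (axialFn V y) V) x l : 𝔸ˣ) : 𝔸) - 1‖ ≤ α * (m + 1) := by
      obtain ⟨μ, b⟩ := l
      cases b
      · rw [stepHol_false]
        refine (norm_inv_sub_one_le (hV₀m _ _)).trans ((axial_bond_bound V hV y h44 hα _ μ).trans ?_)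
        rw [mul_comm]
        refine mul_le_mul_of_nonneg_left ?_ hα
        have : l1 (x - e μ - y) ≤ m + 1 := by simpa [sub_eq_add_neg] using hxl
        exact_mod_cast this
      · rw [stepHol_true]
        refine (axial_bond_bound V hV y h44 hα x μ).trans ?_
        rw [mul_comm]
        refine mul_le_mul_of_nonneg_left ?_ hα
        have : (l1 (x - y) : ℝ) ≤ m := by exact_mod_cast hx
        linarith
    have h1 : ‖((stepHol (gaugeAct (axialFn V y) V) x l : 𝔸ˣ) : 𝔸)‖ ≤ 1 := (mem_U1.mp (stepHol_mem hV₀m x l)).1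
    have h2 := B8Ineq170.norm_mul_sub_one_le_of_norm_le_one (b := ((hol (gaugeAct (axialFn V y) V) (x + l.vec) u : 𝔸ˣ) : 𝔸)) h1
    have h3 : ‖((stepHol (gaugeAct (axialFn V y) V) x l : 𝔸ˣ) : 𝔸) * ↑(hol (gaugeAct (axialFn V y) V) (x + l.vec) u) - 1‖ ≤
        α * (m + 1) + α * (u.length * (m + 1 : ℕ) + u.length * (u.length + 1) / 2) := h2.trans (add_le_add hstep ih)
    refine h3.trans (le_of_eq ?_)
    push_cast
    ring

/-- **The axial gauge along a word from its own base**: `‖V₀,y(u) − 1‖ ≤ α·|u|(|u|+1)∕2`. [cite: Balaban1985Averaging, pp.24-25] -/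
theorem norm_hol_axial_sub_one_le_triangle {V : LSite d → Fin d → 𝔸ˣ} (hV : ∀ x κ, V x κ ∈ U1 𝔸) {α : ℝ} (hα : 0 ≤ α)
    (h44 : ∀ (x : LSite d) (κ μ : Fin d), κ ≠ μ → ‖((hol V x (plaqWord κ μ) : 𝔸ˣ) : 𝔸) - 1‖ ≤ α) (y : LSite d) (u : List (Letter d)) :
    ‖((hol (gaugeAct (axialFn V y) V) y u : 𝔸ˣ) : 𝔸) - 1‖ ≤ α * (u.length * (u.length + 1) / 2) := by
  have h := norm_hol_axial_sub_one_le_of_l1 hV hα h44 y u y 0 (by simp [l1])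
  simpa using h

/-- `2·(q(q+1) + (n−q)(n−q+1)) ≤ (n+1)²` at `q = ⌊n∕2⌋`. [folklore] -/
theorem two_mul_halves_le_sq (n : ℕ) : 2 * ((n / 2) * (n / 2 + 1) + (n - n / 2) * (n - n / 2 + 1)) ≤ (n + 1) ^ 2 := by
  rcases Nat.even_or_odd n with ⟨q, hq⟩ | ⟨q, hq⟩
  · subst hq
    have h1 : (q + q) / 2 = q := by omega
    rw [h1, show q + q - q = q by omega]
    nlinarith
  · subst hq
    have h1 : (2 * q + 1) / 2 = q := by omega
    rw [h1, show 2 * q + 1 - q = q + 1 by omega]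
    nlinarith

/-- ★ **Closed words near `1` with the `n²∕4`-type constant, global plaquette hypothesis**: if `V` is `U1`-valued with `‖V(∂p) − 1‖ ≤ α` for every plaquette of
`ℤᵈ`, then for every CLOSED word `w` of length `n` from `y`, `‖V_y(w) − 1‖ ≤ α·(n+1)²∕4` — split `w = w₁w₂` at `q = ⌊n∕2⌋`; in the axial gauge at `y`,
`V_y(w) = V₀,y(w₁)·(V₀,y(w₂⁻¹))⁻¹` with both factors read FROM `y` (★ above twice), and `2(q(q+1) + (n−q)(n−q+1)) ≤ (n+1)²`. [cite: Balaban1985Averaging, (19)-(20) p.21 and pp.24-25] -/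
theorem norm_hol_closed_sub_one_le_quarter {V : LSite d → Fin d → 𝔸ˣ} (hV : ∀ x κ, V x κ ∈ U1 𝔸) {α : ℝ} (hα : 0 ≤ α)
    (h44 : ∀ (x : LSite d) (κ μ : Fin d), κ ≠ μ → ‖((hol V x (plaqWord κ μ) : 𝔸ˣ) : 𝔸) - 1‖ ≤ α)
    (y : LSite d) (w : List (Letter d)) (hw : disp w = 0) :
    ‖((hol V y w : 𝔸ˣ) : 𝔸) - 1‖ ≤ α * (((w.length : ℝ) + 1) ^ 2 / 4) := by
  set V₀ := gaugeAct (axialFn V y) V with hV₀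
  have hV₀m : ∀ x κ, V₀ x κ ∈ U1 𝔸 := gaugeAct_mem hV (axialFn_mem hV y)
  have hax : axialFn V y y = 1 := by simp [axialFn]
  have heq : hol V y w = hol V₀ y w := by
    rw [hV₀, hol_gaugeAct_closed _ _ _ _ hw, hax, one_mul, inv_one, mul_one]
  set q := w.length / 2 with hq
  set w₁ := w.take q with hw₁
  set w₂ := w.drop q with hw₂
  have hsplit : w = w₁ ++ w₂ := (List.take_append_drop q w).symm
  have hlen₁ : w₁.length = q := by rw [hw₁, List.length_take]; omega
  have hlen₂ : w₂.length = w.length - q := by rw [hw₂, List.length_drop]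
  -- `V₀,y(w) = V₀,y(w₁) · (V₀,y(w₂⁻¹))⁻¹`
  have hdisp : y + disp w₁ = y + disp (revWord w₂) := by
    have : disp w₁ + disp w₂ = 0 := by rw [← disp_append, ← hsplit, hw]
    rw [disp_revWord, eq_neg_of_add_eq_zero_left this]
  have hfac : hol V₀ y w = hol V₀ y w₁ * (hol V₀ y (revWord w₂))⁻¹ := by
    rw [← hol_revWord' V₀ (y + disp w₁) (revWord w₂) hdisp, revWord_revWord, ← hol_append, ← hsplit]
  rw [heq, hfac, Units.val_mul]
  have hA := norm_hol_axial_sub_one_le_triangle hV hα h44 y w₁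
  have hB : ‖(((hol V₀ y (revWord w₂))⁻¹ : 𝔸ˣ) : 𝔸) - 1‖ ≤ α * ((w.length - q : ℕ) * ((w.length - q : ℕ) + 1) / 2) := by
    refine (norm_inv_sub_one_le (hol_mem hV₀m _ _)).trans ?_
    have h := norm_hol_axial_sub_one_le_triangle hV hα h44 y (revWord w₂)
    rw [B7Prop1Explicit.length_revWord, hlen₂] at h
    exact h
  rw [hlen₁] at hA
  have h1 : ‖((hol V₀ y w₁ : 𝔸ˣ) : 𝔸)‖ ≤ 1 := (mem_U1.mp (hol_mem hV₀m _ _)).1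
  have h2 := B8Ineq170.norm_mul_sub_one_le_of_norm_le_one (b := (((hol V₀ y (revWord w₂))⁻¹ : 𝔸ˣ) : 𝔸)) h1
  have hqq : (2 : ℝ) * ((q : ℝ) * (q + 1) + ((w.length - q : ℕ) : ℝ) * (((w.length - q : ℕ) : ℝ) + 1)) ≤ ((w.length : ℝ) + 1) ^ 2 := by
    have := two_mul_halves_le_sq w.length
    rw [← hq] at this
    exact_mod_cast this
  nlinarith [h2, hA, hB, hqq, hα]

/-- ★★ **Closed words near `1` with the `n²∕4`-type constant from the plaquettes INSIDE THE BOX only**: `V` `U1`-valued on the bonds of `[lo, hi]`,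
`‖V(∂p) − 1‖ ≤ α` for the plaquettes with all four corners in `[lo, hi]`, `w` closed from `y` with all positions in `[lo, hi]` ⟹ `‖V_y(w) − 1‖ ≤ α·(|w|+1)²∕4`
(★ applied to the clamped extension `clampCfg lo hi V`, as in `…N18TwoBlockLoopStokes`). [cite: Balaban1985Averaging, (19)-(20) p.21 and pp.24-25] -/
theorem norm_hol_closed_sub_one_le_quarter_inBox {V : LSite d → Fin d → 𝔸ˣ} {lo hi : LSite d} (hlohi : ∀ i, lo i ≤ hi i)
    (hV : ∀ (x : LSite d) (κ : Fin d), InBox lo hi x → InBox lo hi (x + e κ) → V x κ ∈ U1 𝔸) {α : ℝ} (hα : 0 ≤ α)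
    (h44 : ∀ (x : LSite d) (κ μ : Fin d), κ ≠ μ → PlaqIn lo hi (x, κ, μ) → ‖((hol V x (plaqWord κ μ) : 𝔸ˣ) : 𝔸) - 1‖ ≤ α)
    (y : LSite d) (w : List (Letter d)) (hw : disp w = 0) (hwalk : ∀ k, InBox lo hi (y + disp (w.take k))) :
    ‖((hol V y w : 𝔸ˣ) : 𝔸) - 1‖ ≤ α * (((w.length : ℝ) + 1) ^ 2 / 4) := by
  set V' := clampCfg lo hi V with hV'
  have hV'm : ∀ x κ, V' x κ ∈ U1 𝔸 := clampCfg_mem_of_box hlohi hV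
  have h44' : ∀ (x : LSite d) (κ μ : Fin d), κ ≠ μ → ‖((hol V' x (plaqWord κ μ) : 𝔸ˣ) : 𝔸) - 1‖ ≤ α :=
    fun x κ μ hκμ => norm_hol_plaqWord_clampCfg_le hlohi V hκμ hα (fun x' hx' => h44 x' κ μ hκμ hx') x
  have heq : hol V y w = hol V' y w := (hol_congr_of_inBox (clampCfg_agree V) w y hwalk).symm
  rw [heq]
  exact norm_hol_closed_sub_one_le_quarter hV'm hα h44' y w hw

end Zd

/-! ## §2 The torus, two blocks: the (0.4) loop variables with the constant `((d+2)L)²∕4` -/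

section TwoBlocks

open Literature.MathematicalPhysics.QuantumFieldTheory.Balaban1983to89.T4Continuum (netDisp loopWord netDisp_loopWord stairWord)
open Literature.MathematicalPhysics.QuantumFieldTheory.Balaban1983to89.BlockAveraging (Idx off off_bounds)
open Literature.MathematicalPhysics.QuantumFieldTheory.Balaban1983to89.B10Eq27TorusAxialLog (transl pull hol_pull_zero holT)
open Literature.MathematicalPhysics.QuantumFieldTheory.Balaban1983to89.B12RegularSpaces111 (plaq)
open Literature.MathematicalPhysics.QuantumFieldTheory.Balaban1983to89.Node00.W1 (loopVarU)

variable {P : Params} {j : ℕ}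

/-- **The (0.4) loop word has length `2|n|₁ + 2L ≤ (d+2)L − d`** (two staircases of `≤ d·(L−1)∕2` letters, two straight runs of `L`; `L` odd).
[cite: Balaban1987RG1, (0.3)-(0.4) pp.252-253] -/
theorem length_loopWord_add_le (c : PBond P (j + 1)) (i : Idx P) :
    (loopWord P.L c.dir (off i.1) i.2.1 i.2.2).length + P.d ≤ (P.d + 2) * P.L := by
  have hL := AveragingRT.two_mul_half_add_one P
  have hN : ∀ ν, (off i.1 ν).natAbs ≤ (P.L - 1) / 2 := fun ν => by have h := off_bounds i.1 ν; omega
  have h₁ := LatticeWordStokes.length_stairWord_le i.2.1 (off i.1) _ hN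
  have h₂ := LatticeWordStokes.length_stairWord_le i.2.2 (off i.1) _ hN
  have hrev : (T4Continuum.wordRev (stairWord i.2.2 (off i.1))).length = (stairWord i.2.2 (off i.1)).length := by
    simp [T4Continuum.wordRev]
  simp only [loopWord, List.length_append, List.length_replicate, hrev]
  have hd : P.d * (2 * ((P.L - 1) / 2) + 1) = P.d * P.L := by rw [hL]
  nlinarith [h₁, h₂, hd]

variable {𝔸 : Type*} [NormedRing 𝔸] [NormOneClass 𝔸]

/-- ★★★ **THE (0.4) LOOP VARIABLES FROM THE PLAQUETTES OF THE TWO-BLOCK BOX, SHARP CONSTANT**: under the hypotheses of `…N18TwoBlockLoopStokes`'s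
`norm_loopVarU_sub_one_le_of_plaq_twoBlock` (`U1` on the two-block bonds, `‖U(∂p) − 1‖ ≤ a` on the two-block plaquettes, `j+1 ≤ m+K`),
`‖W_i(c) − 1‖ ≤ (((d+2)L)²∕4)·a` — the constant of the tree's GLOBAL `LatticeWordStokes.dist1_loopHol_le`, now from the two blocks only
(§1 ★★ with `(|w|+1)² ≤ ((d+2)L)²`). [cite: Balaban1987RG1, (0.4) p.253; Balaban1985Averaging, (19)-(20) p.21 and pp.24-25] -/
theorem norm_loopVarU_sub_one_le_quarter (hj : j + 1 ≤ P.m + P.K) {U : GaugeField P j 𝔸ˣ} (c : PBond P (j + 1)) {a : ℝ} (ha : 0 ≤ a)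
    (hU1 : ∀ b : PBond P j, (blockOf b.src = c.src ∨ blockOf b.src = c.tgt) → (blockOf b.tgt = c.src ∨ blockOf b.tgt = c.tgt) → U b ∈ U1 𝔸)
    (hplaq : ∀ p : Plaq P j, (blockOf p.src = c.src ∨ blockOf p.src = c.tgt) →
      (blockOf (p.src.shift p.μ) = c.src ∨ blockOf (p.src.shift p.μ) = c.tgt) →
      (blockOf (p.src.shift p.ν) = c.src ∨ blockOf (p.src.shift p.ν) = c.tgt) →
      (blockOf ((p.src.shift p.μ).shift p.ν) = c.src ∨ blockOf ((p.src.shift p.μ).shift p.ν) = c.tgt) →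
      ‖((plaq U p : 𝔸ˣ) : 𝔸) - 1‖ ≤ a) (i : Idx P) :
    ‖((loopVarU U c i : 𝔸ˣ) : 𝔸) - 1‖ ≤ ((((P.d + 2) * P.L : ℕ) : ℝ) ^ 2 / 4) * a := by
  have hw0 : disp (loopWord P.L c.dir (off i.1) i.2.1 i.2.2) = 0 := funext fun ν => by
    rw [disp_apply_eq_netDisp]; exact netDisp_loopWord _ _ _ _ _ ν
  have hmain := norm_hol_closed_sub_one_le_quarter_inBox (twoBlockBox_lo_le_hi c) (pull_mem_U1_of_twoBlock hj c hU1) ha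
    (norm_hol_pull_plaqWord_sub_one_le_of_twoBlock hj c hU1 hplaq) 0 _ hw0 (inBox_disp_take_loopWord c i)
  rw [hol_pull_zero] at hmain
  unfold loopVarU
  refine hmain.trans ?_
  have hlen : ((loopWord P.L c.dir (off i.1) i.2.1 i.2.2).length : ℝ) + 1 ≤ (((P.d + 2) * P.L : ℕ) : ℝ) := by
    have h := length_loopWord_add_le c i
    have hd := P.hd
    have : (loopWord P.L c.dir (off i.1) i.2.1 i.2.2).length + 1 ≤ (P.d + 2) * P.L := by omega
    exact_mod_cast this
  have h0 : (0 : ℝ) ≤ ((loopWord P.L c.dir (off i.1) i.2.1 i.2.2).length : ℝ) + 1 := by positivity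
  calc a * ((((loopWord P.L c.dir (off i.1) i.2.1 i.2.2).length : ℝ) + 1) ^ 2 / 4)
      ≤ a * ((((P.d + 2) * P.L : ℕ) : ℝ) ^ 2 / 4) := by
        refine mul_le_mul_of_nonneg_left (div_le_div_of_nonneg_right ?_ (by norm_num)) ha
        exact pow_le_pow_left₀ h0 hlen 2
    _ = ((((P.d + 2) * P.L : ℕ) : ℝ) ^ 2 / 4) * a := by ring

end TwoBlocks

end YMDAG.N18.BoxStokes

end
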